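import Literature.Computability.AlgebraicComplexity.QuantumFunctionalsFree
import Literature.Computability.AlgebraicComplexity.QuantumFunctionalsUpperSupportProofs
import HarnessLib

/-!
# `ρ^θ = E_θ` and `ζ^θ = F^θ` on free tensors (CVZ Thm. 4.20): discharge

Topic: `Literature/Computability/AlgebraicComplexity`. Discharge of the named fact
`ChristandlVranaZuiddam2023_free` of `QuantumFunctionals.lean` (M. Christandl, P. Vrana, J. Zuiddam,
*Universal points in the asymptotic spectrum of tensors*, J. Amer. Math. Soc. 36 (2023) =
arXiv:1709.07851v3, Thm. 4.20: for a free tensor `t` and `θ ∈ P([3])`, `ρ^θ(t) = E_θ(t)` and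
`ζ^θ(t) = F^θ(t)`).

The printed proof has two halves, both in the tree:
* `ρ^θ(t) ≥ E_θ(t)` for every `t` — Thm. 3.34, the named fact
  `ChristandlVranaZuiddam2023_le_upperSupportFunctional`, discharged in
  `QuantumFunctionalsUpperSupportProofs.lean` (`…_le_upperSupportFunctional_holds`);
* `ρ^θ(t) ≤ E_θ(t)` for free `t` (p. 24: diagonal torus action on the free support, Gibbs
  distributions) — `logUpperSupportFunctional_le_logQuantumFunctional_of_isFree` in
  `QuantumFunctionalsFree.lean`, packaged there as the reduction
  `ChristandlVranaZuiddam2023_free_of_le_upperSupportFunctional`.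

This file only composes the two. Theorems only; no definitions, no named facts.
-/

noncomputable section

namespace Literature.Computability.AlgebraicComplexity

universe u

/-- **CVZ Thm. 4.20 holds** (`ChristandlVranaZuiddam2023_free`): for every free complex 3-tensor `t`
and `θ ∈ P([3])`, `ρ^θ(t) = E_θ(t)` and `ζ^θ(t) = F^θ(t)` — by the reduction
`ChristandlVranaZuiddam2023_free_of_le_upperSupportFunctional` (the half `ρ^θ ≤ E_θ` for free `t`,
`QuantumFunctionalsFree.lean`) applied to the discharge of Thm. 3.34
(`ChristandlVranaZuiddam2023_le_upperSupportFunctional_holds`, `QuantumFunctionalsUpperSupportProofs.lean`).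
[cite: ChristandlVranaZuiddam2023, Thm. 4.20] -/
theorem ChristandlVranaZuiddam2023_free_holds : ChristandlVranaZuiddam2023_free.{u} :=
  ChristandlVranaZuiddam2023_free_of_le_upperSupportFunctional
    ChristandlVranaZuiddam2023_le_upperSupportFunctional_holds

end Literature.Computability.AlgebraicComplexity

end
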